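import Mathlib
import HarnessLib

/-!
# Backward Grönwall lemma (stub `stub_backwardGronwall`, line `registered` of the crux
`HubbleDynamo.NoSelfExcitedDynamo`, item `stmt-NavierStokesRegularity-1934`)

Pure real analysis on `ℝ`. A nonnegative function `E : ℝ → ℝ` bounded above by `M` whose increments
satisfy `E s₁ - E s₀ ≤ -c * ∫ s in s₀..s₁, E s` for all `s₀ ≤ s₁` (with `c > 0`) vanishes
identically. Proof: the interval integral of a pointwise nonnegative function over `s₀ ≤ s₁` is
nonnegative (whatever its integrability), so `E` is antitone; an antitone function is interval
integrable and dominates the constant `E s₁` on `[s₀, s₁]`, whence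
`c * (s₁ - s₀) * E s₁ ≤ c * ∫_{s₀}^{s₁} E ≤ E s₀ - E s₁ ≤ M`; choosing `s₀` far enough in the past
contradicts `E s₁ > 0`.

In the line, `E s = ∫ ‖curl U s‖²` is the enstrophy of an eternal solution of Leray's backward system
(bounded for all past times with a uniform exponential decay rate, hence zero).
-/

noncomputable section

open Set MeasureTheory Filter Topology intervalIntegral

namespace Summit.NavierStokesRegularity.NavierStokesRegularity.Theorems.NoSelfExcitedDynamo.Registered

/-- If `E` is pointwise nonnegative and `E s₁ - E s₀ ≤ -c * ∫ s in s₀..s₁, E s` whenever `s₀ ≤ s₁`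
(with `0 < c`), then `E` is antitone. No integrability is needed: the interval integral of a pointwise
nonnegative function over an ordered interval is nonnegative by convention. -/
theorem gronwall_antitone (E : ℝ → ℝ) (c : ℝ) (hc : 0 < c) (hE0 : ∀ s, 0 ≤ E s)
    (hinc : ∀ s₀ s₁ : ℝ, s₀ ≤ s₁ → E s₁ - E s₀ ≤ -c * ∫ s in s₀..s₁, E s) : Antitone E := by
  intro a b hab
  have hint : 0 ≤ ∫ s in a..b, E s := intervalIntegral.integral_nonneg hab fun u _ => hE0 u
  have h := hinc a b hab
  nlinarith

/-- For an antitone `E` and `s₀ ≤ s₁`, the constant `E s₁` integrates below `E` on `[s₀, s₁]`: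
`(s₁ - s₀) * E s₁ ≤ ∫ s in s₀..s₁, E s`. -/
theorem gronwall_mul_le_integral (E : ℝ → ℝ) (hanti : Antitone E) {s₀ s₁ : ℝ} (h : s₀ ≤ s₁) :
    (s₁ - s₀) * E s₁ ≤ ∫ s in s₀..s₁, E s := by
  have h1 : ∫ _ in s₀..s₁, E s₁ = (s₁ - s₀) * E s₁ := by
    simp only [intervalIntegral.integral_const, smul_eq_mul]
  rw [← h1]
  exact intervalIntegral.integral_mono_on h intervalIntegrable_const hanti.intervalIntegrable
    fun x hx => hanti hx.2

/-- **Backward Grönwall lemma** (stub `stub_backwardGronwall`). A nonnegative function on `ℝ`,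
bounded above by `M`, whose increments satisfy `E s₁ - E s₀ ≤ -c * ∫ s in s₀..s₁, E s` for all
`s₀ ≤ s₁` with `c > 0`, vanishes identically: it is antitone, so
`c * (s₁ - s₀) * E s₁ ≤ c * ∫_{s₀}^{s₁} E ≤ E s₀ - E s₁ ≤ M` for every `s₀ ≤ s₁`, and
`s₀ = s₁ - (M + 1) / (c * E s₁)` is absurd unless `E s₁ = 0`. -/
theorem stub_backwardGronwall :
    ∀ (E : ℝ → ℝ) (c M : ℝ), 0 < c → (∀ s, 0 ≤ E s) → (∀ s, E s ≤ M) →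
      (∀ s₀ s₁ : ℝ, s₀ ≤ s₁ → E s₁ - E s₀ ≤ -c * ∫ s in s₀..s₁, E s) →
      ∀ s, E s = 0 := by
  intro E c M hc hE0 hEM hinc s
  have hanti : Antitone E := gronwall_antitone E c hc hE0 hinc
  -- the key a priori bound: `c * (s - s₀) * E s ≤ M` for every `s₀ ≤ s`
  have hbound : ∀ s₀, s₀ ≤ s → c * (s - s₀) * E s ≤ M := by
    intro s₀ hs₀
    have h1 := gronwall_mul_le_integral E hanti hs₀
    have h2 := hinc s₀ s hs₀
    have h3 := hEM s₀
    have h4 := hE0 s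
    nlinarith
  by_contra hne
  have hpos : 0 < E s := lt_of_le_of_ne (hE0 s) (Ne.symm hne)
  have hcE : 0 < c * E s := mul_pos hc hpos
  have hM : 0 ≤ M := (hE0 s).trans (hEM s)
  -- go back far enough in the past: `s₀ = s - (M + 1) / (c * E s)`
  have hs₀le : s - (M + 1) / (c * E s) ≤ s := by
    have : 0 ≤ (M + 1) / (c * E s) := div_nonneg (by linarith) hcE.le
    linarith
  have hb := hbound (s - (M + 1) / (c * E s)) hs₀le
  have hcalc : c * (s - (s - (M + 1) / (c * E s))) * E s = M + 1 := by
    field_simp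
    ring
  linarith

end Summit.NavierStokesRegularity.NavierStokesRegularity.Theorems.NoSelfExcitedDynamo.Registered

end
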